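import Summits.BirchSwinnertonDyer.Rank1Residual.Additive.X3BranchCertificateRoad
import Summits.BirchSwinnertonDyer.Rank1Residual.Additive.X3BranchGordEndStateIntrinsic
import Summits.BirchSwinnertonDyer.Rank1Residual.Additive.X3BranchAlgebraicCountWOfLifting
import Summits.BirchSwinnertonDyer.Rank1Residual.Additive.CensusQ6UnitCoeffCertificate
import HarnessLib

/-!
# X3♯(G-ord, `e = 2`), rank `0`, every odd `p`: the CERTIFICATE ROAD end state —
# `ChiBranchLowerDivisibilityAt` / `ChiBranchLowerLeadingTerm[Odd]At` / `CycLowerLeadingTermAt W p`,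
# `Typed.MissingLowerBoundAt W p` and `BSD(E,p)` from PUBLISHED records ∧ ONE unit-coefficient
# certificate ∧ the algebraic `λ` (`hLamW`) — ANOMALOUS twists included, DEGENERATE `p = 3` rows hosted
# (cell `bsd-eis`, seat `bsd-eis-x3` gen 2; sequel of `X3BranchCertificateRoad.lean`; route K1
# `AdditiveBranchIMC`, crux `GordTwoRankZeroOffCaseOne` / support `X3CaseOneRankZero` — supports only)

HONEST FRAMING (cell `bsd-eis`, `run/shared/lean/pub/bsd-eis/README.md` §4): the programme's target of
record is the full Birch–Swinnerton-Dyer formula for every `E/ℚ` of analytic rank `≤ 1`; this file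
concerns X3♯(G-ord) ∩ `I₀*` (`e = 2`) ∩ `r_an = 0` (`E = W` additive potentially good ordinary at the
odd `p` with semistability defect `2`, `E[p]` reducible). THEOREMS ONLY (no `def`, no named fact, no
`sorry`); nothing booked. The analytic input `hGV` (GV Thm. (3.12) on the branch, PRINTED for the
ramified even line at `p ≥ 5` / the non-degenerate rows at `p = 3`) of bsd-addord's end states is
REPLACED by the two per-pair displayed inputs of `X3BranchCertificateRoad.lean` (`hcert`, `hLamW`) —
the ONLY road typed so far for the rows `hGV` does not reach: the DEGENERATE `p = 3` rows (even line
= the rational-point line; x3-MEMO-3 (ALG-deg′)), whose `hLamW` (`n = Σ s_ℓ t_ℓ(E) − 2`) is x3's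
next Lean target. §3: `hLamW` on the NON-degenerate rows from bsd-addord's counts + the displayed
EVALUATION `hn`; §4: `hcert` from the census cell's Q6 records. Every other hypothesis is a PUBLISHED
record or the class / line datum. NOT a class theorem; no label, tier or count of record moves.

References: [Delbourgo1998] Thm. 3, Prop. 4; [Wuthrich2014] Thm. 16, Cor. 18; [Pal2012] Thm. 3.2;
[GreenbergVatsal2000] §2 (11), (16), Props. (2.6)/(2.8), Cor. (2.3); [GreenbergLNM1716] Props. 2.2, 2.4,
4.14, §3 Lemma 3.4; [MazurTateTeitelbaum1986Invent] §I.13–I.14; [Miller2011LMS] Def. 1.1.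
-/

set_option autoImplicit false

noncomputable section

open scoped Classical MatrixGroups ModularForm

namespace Summit.BirchSwinnertonDyer.Rank1Residual.Additive

open CongruenceSubgroup WeierstrassCurve NumberField IsDedekindDomain Field
  Literature.NumberTheory.EllipticCurves
  Literature.NumberTheory.EllipticCurves.ModularForms
  Literature.NumberTheory.EllipticCurves.GreenbergVatsal2000
  Literature.NumberTheory.EllipticCurves.Rank1Residual
  Literature.NumberTheory.EllipticCurves.Rank1Residual.Typed
  Literature.NumberTheory.GaloisRepresentations
  Summit.BirchSwinnertonDyer.Rank1Residual.X1.MuLambda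
  Summit.BirchSwinnertonDyer.Rank1Residual.AdditivePotMult
  Summit.BirchSwinnertonDyer.Rank1Residual.Additive.X3Branch

/-! ### §1 The LOWER inputs on X3♯(G-ord, `e = 2`) from the two per-pair inputs -/

section LowerInputs

variable {W : WeierstrassCurve ℚ} [W.IsElliptic] [W.IsGloballyMinimal] {p : ℕ} [hp : Fact p.Prime]

omit [W.IsGloballyMinimal] in
/-- **X3♯(G-ord, `e = 2`), `p ≡ 1 (mod 4)`: the Λ-adic integral containment
`ChiBranchLowerDivisibilityAt W p` from `hW16` + the `W`-keyed certificate + `hLamW`** (the def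
supplies the good-ordinary twist model; `W[p]` reducible, `hred`). Twin of bsd-addord's
`X3Branch.chiBranchLowerDivisibilityAt_of_facts` with {`hGV`, counts, `Φ₀`} ↦ {`hcert`, `hLamW`}.
[cite: SkinnerUrban2014, Thm. 3.6.4 (p. 43) (shape only)] [cite: Wuthrich2014, Thm. 16 (p. 397)] -/
theorem X3Branch.chiBranchLowerDivisibilityAt_of_unitCoeffCert_of_lamEqW
    (hW16 : Wuthrich2014.thm16_halfEigenCharIdeal_dvd_cyclotomicPrime) (hred : Red W p) {n : ℕ}
    (hcert : ∀ (V : WeierstrassCurve ℚ) [V.IsElliptic] [V.IsGloballyMinimal] (C : VariableChange ℚ),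
      C • V.quadraticTwist ((-1) ^ (p / 2) * p : ℚ) = W → X3BranchUnitCoeffCertAt V p n)
    (hLamW : ∀ {κ : ZpExtension ℚ p} {γ : Field.absoluteGaloisGroup ℚ} (D : W.SelmerDualData κ γ)
      (g : IwasawaAlgebra p), κ.IsCyclotomic → κ.IsTopGenerator γ → D.IsTorsion →
      D.charIdeal = Ideal.span {g} → HasUnitContent g → lam g = n) :
    ChiBranchLowerDivisibilityAt W p := by
  intro V _ _ κ γ N _ f hp1 hCW hgood hκ hγ hcv hf D ϖ hϖ g hg
  have hp2 : p ≠ 2 := by omega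
  have heven' : Even (p / 2) := ⟨p / 4, by omega⟩
  have hpS : ((-1 : ℚ) ^ (p / 2) * p) ≠ 0 := pStar_ne_zero p
  obtain ⟨C, hC⟩ := hCW
  have hC' : C • V.quadraticTwist ((-1) ^ (p / 2) * p : ℚ) = W := by
    rw [pStar_eq_self_of_mod_four_eq_one hp1]; exact hC
  have hirr : ¬ V.HasIrreducibleModPGaloisRep p := fun hV ↦
    hred ((irr_iff_of_model_twist (W := V) (p := p) hpS ⟨C, hC'⟩).mpr hV)
  have hord : IsOrdinaryAt V p := (isOrdinaryAt_iff V p).mpr ⟨hgood.1, hgood.2⟩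
  obtain ⟨-, g', hchar, u, hι⟩ :=
    X3Branch.charIdeal_eq_span_of_unitCoeffCert_of_lamEqW hW16 hp2 hirr hC' (hcert V C hC') hLamW hκ
      hγ hcv hf (Or.inl ⟨hord, rfl⟩) D ϖ (by rw [if_pos heven']; exact hϖ)
  rw [if_pos heven'] at hι
  have hg' : g ∈ Ideal.span ({g'} : Set (IwasawaAlgebra p)) := by rw [← hchar]; exact hg
  obtain ⟨a, rfl⟩ := Ideal.mem_span_singleton'.mp hg'
  refine ⟨PowerSeries.C (u : ℤ_[p]) * a, ?_⟩
  have hCu : PowerSeries.C ((((u : ℤ_[p]) : ℚ_[p])) * (ϖ : ℚ_[p])) =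
      PowerSeries.C (((u : ℤ_[p]) : ℚ_[p])) * PowerSeries.C (ϖ : ℚ_[p]) := map_mul _ _ _
  rw [map_mul, hι, iwasawaToPowerSeries_C_mul', hCu]
  ring

omit [W.IsGloballyMinimal] in
/-- **X3♯(G-ord), `p ≡ 1 (mod 4)`: the `T = 0` LOWER input `ChiBranchLowerLeadingTermAt W p` from
`hW16` + the certificate + `hLamW`** (the integral `j` of type (G) and the containment).
[cite: MazurTateTeitelbaum1986Invent, §I.14] [cite: Wuthrich2014, Thm. 16 (p. 397)] -/
theorem ClassX3Gord.chiBranchLowerLeadingTermAt_of_unitCoeffCert_of_lamEqW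
    (hW16 : Wuthrich2014.thm16_halfEigenCharIdeal_dvd_cyclotomicPrime) (hX : ClassX3Gord W p) {n : ℕ}
    (hcert : ∀ (V : WeierstrassCurve ℚ) [V.IsElliptic] [V.IsGloballyMinimal] (C : VariableChange ℚ),
      C • V.quadraticTwist ((-1) ^ (p / 2) * p : ℚ) = W → X3BranchUnitCoeffCertAt V p n)
    (hLamW : ∀ {κ : ZpExtension ℚ p} {γ : Field.absoluteGaloisGroup ℚ} (D : W.SelmerDualData κ γ)
      (g : IwasawaAlgebra p), κ.IsCyclotomic → κ.IsTopGenerator γ → D.IsTorsion →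
      D.charIdeal = Ideal.span {g} → HasUnitContent g → lam g = n) :
    ChiBranchLowerLeadingTermAt W p :=
  chiBranchLowerLeadingTermAt_of_divisibility_of_padicValRat_j_nonneg p W
    (padicValRat_j_nonneg_of_typeGOrd W p hX.typeGOrd)
    (X3Branch.chiBranchLowerDivisibilityAt_of_unitCoeffCert_of_lamEqW hW16 hX.classX3.1 hcert hLamW)

/-- **X3♯(G-ord, `e = 2`), `p ≡ 3 (mod 4)` (`p = 3` included): the ODD `T = 0` LOWER input
`ChiBranchLowerLeadingTermOddAt W p` from `hW16` + the certificate + `hLamW`** (every twist model is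
good ordinary, `TypeGOrd.goodOrd_of_pStar_twist_model`; §2 on the MINUS branch; additive-p2's
`exists_padicInt_constantCoeff_eq_of_iwasawaToPowerSeries_eq_mul_minusBranch`). Twin of bsd-addord's
`ClassX3Gord.chiBranchLowerLeadingTermOddAt_of_facts`.
[cite: MazurTateTeitelbaum1986Invent, §I.13–I.14] [cite: Wuthrich2014, Thm. 16 (p. 397)] -/
theorem ClassX3Gord.chiBranchLowerLeadingTermOddAt_of_unitCoeffCert_of_lamEqW
    (hW16 : Wuthrich2014.thm16_halfEigenCharIdeal_dvd_cyclotomicPrime) (hX : ClassX3Gord W p)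
    (he : semistabilityIndex W p = 2) {n : ℕ}
    (hcert : ∀ (V : WeierstrassCurve ℚ) [V.IsElliptic] [V.IsGloballyMinimal] (C : VariableChange ℚ),
      C • V.quadraticTwist ((-1) ^ (p / 2) * p : ℚ) = W → X3BranchUnitCoeffCertAt V p n)
    (hLamW : ∀ {κ : ZpExtension ℚ p} {γ : Field.absoluteGaloisGroup ℚ} (D : W.SelmerDualData κ γ)
      (g : IwasawaAlgebra p), κ.IsCyclotomic → κ.IsTopGenerator γ → D.IsTorsion →
      D.charIdeal = Ideal.span {g} → HasUnitContent g → lam g = n) :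
    ChiBranchLowerLeadingTermOddAt W p := by
  intro V _ _ κ γ N _ f hp3 hCW _ hκ hγ hcv hf D ϖ hϖ g hg
  have hp2 : p ≠ 2 := by omega
  have hodd : ¬ Even (p / 2) := by rw [Nat.not_even_iff_odd]; exact ⟨p / 4, by omega⟩
  have hpS : ((-1 : ℚ) ^ (p / 2) * p) ≠ 0 := pStar_ne_zero p
  obtain ⟨C, hC⟩ := hCW
  have hC' : C • V.quadraticTwist ((-1) ^ (p / 2) * p : ℚ) = W := by
    rw [pStar_eq_neg_of_mod_four_eq_three hp3]; exact hC
  have hgood : GoodOrd V p := TypeGOrd.goodOrd_of_pStar_twist_model hp2 hX.typeGOrd hX.addv he ⟨C, hC'⟩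
  have hord : IsOrdinaryAt V p := (isOrdinaryAt_iff V p).mpr ⟨hgood.1, hgood.2⟩
  have hirr : ¬ V.HasIrreducibleModPGaloisRep p := fun hV ↦
    hX.classX3.1 ((irr_iff_of_model_twist (W := V) (p := p) hpS ⟨C, hC'⟩).mpr hV)
  obtain ⟨-, g', hchar, u, hι⟩ :=
    X3Branch.charIdeal_eq_span_of_unitCoeffCert_of_lamEqW hW16 hp2 hirr hC' (hcert V C hC') hLamW hκ
      hγ hcv hf (Or.inl ⟨hord, rfl⟩) D ϖ (by rw [if_neg hodd]; exact hϖ)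
  rw [if_neg hodd] at hι
  have hg' : g ∈ Ideal.span ({g'} : Set (IwasawaAlgebra p)) := by rw [← hchar]; exact hg
  obtain ⟨a, rfl⟩ := Ideal.mem_span_singleton'.mp hg'
  have hCu : PowerSeries.C ((((u : ℤ_[p]) : ℚ_[p])) * (ϖ : ℚ_[p])) =
      PowerSeries.C (((u : ℤ_[p]) : ℚ_[p])) * PowerSeries.C (ϖ : ℚ_[p]) := map_mul _ _ _
  have hιg : iwasawaToPowerSeries p (a * g') =
      iwasawaToPowerSeries p (PowerSeries.C (u : ℤ_[p]) * a) *
        (PowerSeries.C ((ϖ : ℚ) : ℚ_[p]) *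
          padicLFunctionMinusBranch f (unitRoot V p : ℚ_[p]) (p / 2)) := by
    rw [map_mul, hι, iwasawaToPowerSeries_C_mul', hCu]
    ring
  exact exists_padicInt_constantCoeff_eq_of_iwasawaToPowerSeries_eq_mul_minusBranch p hp2 V hord hf hιg

/-- **X3♯(G-ord) ∩ `I₀*` (`e = 2`), every odd `p`: the cyclotomic `T = 0` LOWER input
`CycLowerLeadingTermAt W p` from `hW16` + the certificate + `hLamW`** (Birch + Pal transport; twin of
bsd-addord's `ClassX3Gord.cycLowerLeadingTermAt_of_facts`; rank-free). [cite: Pal2012, Thm. 3.2]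
[cite: MazurTateTeitelbaum1986Invent, §I.13–I.14] [cite: Wuthrich2014, Thm. 16 (p. 397)] -/
theorem ClassX3Gord.cycLowerLeadingTermAt_of_unitCoeffCert_of_lamEqW
    (hW16 : Wuthrich2014.thm16_halfEigenCharIdeal_dvd_cyclotomicPrime)
    (hmod : hasEntireLFunction_rat) (hmodD : nonempty_modularParametrizationData)
    (hX : ClassX3Gord W p) (hp2 : p ≠ 2) (he : semistabilityIndex W p = 2) {n : ℕ}
    (hcert : ∀ (V : WeierstrassCurve ℚ) [V.IsElliptic] [V.IsGloballyMinimal] (C : VariableChange ℚ),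
      C • V.quadraticTwist ((-1) ^ (p / 2) * p : ℚ) = W → X3BranchUnitCoeffCertAt V p n)
    (hLamW : ∀ {κ : ZpExtension ℚ p} {γ : Field.absoluteGaloisGroup ℚ} (D : W.SelmerDualData κ γ)
      (g : IwasawaAlgebra p), κ.IsCyclotomic → κ.IsTopGenerator γ → D.IsTorsion →
      D.charIdeal = Ideal.span {g} → HasUnitContent g → lam g = n) :
    CycLowerLeadingTermAt W p := by
  have hodd := hp.out.eq_two_or_odd'
  by_cases hp4 : p % 4 = 1
  · exact (cycLowerLeadingTermAt_iff_chiBranchLower_of_typeGOrd_of_semistabilityIndex_eq_two W p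
      pal2012_thm32_sqrt_mul_realPeriodRat_twist_eq_of_prime_one_mod_four_holds hmod hmodD hp4 hX.addv
      hX.typeGOrd he).mpr
      (ClassX3Gord.chiBranchLowerLeadingTermAt_of_unitCoeffCert_of_lamEqW hW16 hX hcert hLamW)
  · have hp4' : p % 4 = 3 := by
      rcases hodd with h | h
      · exact absurd h hp2
      · obtain ⟨k, hk⟩ := h; omega
    exact (cycLowerLeadingTermAt_iff_chiBranchLowerOdd_of_typeGOrd_of_semistabilityIndex_eq_two W p
      hmod hmodD hp4' hX.addv hX.typeGOrd he).mpr
      (ClassX3Gord.chiBranchLowerLeadingTermOddAt_of_unitCoeffCert_of_lamEqW hW16 hX he hcert hLamW)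

end LowerInputs

/-! ### §2 Rank-`0` END STATES on X3♯(G-ord) ∩ `I₀*` (anomalous twists included) -/

section EndStates

variable {W : WeierstrassCurve ℚ} [W.IsElliptic] [W.IsGloballyMinimal] {p : ℕ} [hp : Fact p.Prime]

/-- **X3♯(G-ord) ∩ `I₀*` (`e = 2`) ∧ `r_an = 0`, every odd `p`, ANOMALOUS twists included, no CM
hypothesis: `Typed.MissingLowerBoundAt W p` from the PUBLISHED records `hDelG` (Delbourgo 1998 Prop. 4
intrinsic), `hGZK`, `hmod`, `hmodD`, `hW16` + the two per-pair inputs.** The certificate twin of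
bsd-addord's `ClassX3Gord.missingLowerBoundAt_rankZero_of_facts_intrinsic` ({`hGV`, `h23`, `h414`,
`hGrK`, `hLiftF`, `Φ₀`} ↦ {`hcert`, `hLamW`}); serves ALSO the no-Case-1 (G-ord) rows of route K1's
crux `GordTwoRankZeroOffCaseOne` (e.g. the DEGENERATE `p = 3` rows) once their `hLamW` is supplied.
[cite: Delbourgo1998, Prop. 4 (p. 144)] [cite: GreenbergLNM1716, §3 Lemma 3.4 (p. 89)]
[cite: Wuthrich2014, Thm. 16 (p. 397)] [cite: Pal2012, Thm. 3.2] [cite: Miller2011LMS, Def. 1.1] -/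
theorem ClassX3Gord.missingLowerBoundAt_rankZero_of_unitCoeffCert_of_lamEqW
    (hDelG : Delbourgo1998.prop4_rankZero_constantCoeff_eq_unit_mul_of_potGoodOrd)
    (hGZK : rank_eq_analyticRank_of_analyticRank_le_one) (hmod : hasEntireLFunction_rat)
    (hmodD : nonempty_modularParametrizationData)
    (hW16 : Wuthrich2014.thm16_halfEigenCharIdeal_dvd_cyclotomicPrime)
    (hX : ClassX3Gord W p) (hp2 : p ≠ 2) (he : semistabilityIndex W p = 2) (hr : W.analyticRank = 0)
    {n : ℕ}
    (hcert : ∀ (V : WeierstrassCurve ℚ) [V.IsElliptic] [V.IsGloballyMinimal] (C : VariableChange ℚ),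
      C • V.quadraticTwist ((-1) ^ (p / 2) * p : ℚ) = W → X3BranchUnitCoeffCertAt V p n)
    (hLamW : ∀ {κ : ZpExtension ℚ p} {γ : Field.absoluteGaloisGroup ℚ} (D : W.SelmerDualData κ γ)
      (g : IwasawaAlgebra p), κ.IsCyclotomic → κ.IsTopGenerator γ → D.IsTorsion →
      D.charIdeal = Ideal.span {g} → HasUnitContent g → lam g = n) :
    MissingLowerBoundAt W p :=
  ClassX3Gord.missingLowerBoundAt_rankZero_of_cycLowerLeadingTerm_of_exact hGZK hmod hX hr
    (ClassX3Gord.cycLowerLeadingTermAt_of_unitCoeffCert_of_lamEqW hW16 hmod hmodD hX hp2 he hcert hLamW)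
    (ClassX3Gord.exactLeadingTermAt_of_prop4Intrinsic hDelG hGZK hp2 hX hr)

/-- **X3♯(G-ord) ∩ `I₀*` (`e = 2`), `p ≥ 5`, `r_an = 0`, anomalous twists included: Miller's
`BSD(E,p)` from the PUBLISHED records + the two per-pair inputs** (lower half: the previous theorem;
upper half: Wuthrich's component divisibility from `hW16` + De98 Prop. 4 weak form `hDel98` + Pal, as
in bsd-addord's `ClassX3Gord.bsdp_rankZero_of_facts_intrinsic`). NOT a class theorem; nothing booked.
[cite: Delbourgo1998, Prop. 4 (p. 144)] [cite: Wuthrich2014, Thm. 16 (p. 397), Cor. 18]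
[cite: Pal2012, Thm. 3.2] [cite: Miller2011LMS, §1 and Def. 1.1] -/
theorem ClassX3Gord.bsdp_rankZero_of_unitCoeffCert_of_lamEqW
    (hDelG : Delbourgo1998.prop4_rankZero_constantCoeff_eq_unit_mul_of_potGoodOrd)
    (hDel98 : Delbourgo1998.prop4_rankZero_pow_dvd_constantCoeff)
    (hGZK : rank_eq_analyticRank_of_analyticRank_le_one) (hmod : hasEntireLFunction_rat)
    (hmodD : nonempty_modularParametrizationData)
    (hW16 : Wuthrich2014.thm16_halfEigenCharIdeal_dvd_cyclotomicPrime)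
    (hX : ClassX3Gord W p) (hp5 : 5 ≤ p) (he : semistabilityIndex W p = 2) (hr : W.analyticRank = 0)
    {n : ℕ}
    (hcert : ∀ (V : WeierstrassCurve ℚ) [V.IsElliptic] [V.IsGloballyMinimal] (C : VariableChange ℚ),
      C • V.quadraticTwist ((-1) ^ (p / 2) * p : ℚ) = W → X3BranchUnitCoeffCertAt V p n)
    (hLamW : ∀ {κ : ZpExtension ℚ p} {γ : Field.absoluteGaloisGroup ℚ} (D : W.SelmerDualData κ γ)
      (g : IwasawaAlgebra p), κ.IsCyclotomic → κ.IsTopGenerator γ → D.IsTorsion →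
      D.charIdeal = Ideal.span {g} → HasUnitContent g → lam g = n) :
    BSDp W p :=
  bsdp_of_missingPPartAt W p hGZK (by rw [hr]; exact zero_le_one)
    (missingPPartAt_of_lower_of_upper W p
      (ClassX3Gord.missingLowerBoundAt_rankZero_of_unitCoeffCert_of_lamEqW hDelG hGZK hmod hmodD hW16
        hX (by omega) he hr hcert hLamW)
      (ClassX3Gord.missingUpperBoundAt_rankZero_of_cycLeadingTerm hDel98 hGZK hmod hX hp5 hr
        (ClassX3Gord.cycLeadingTermAt_of_wuthrichComponent W p
          (Wuthrich2014.charIdeal_dvd_padicLFunctionBranch_component_of_half hW16)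
          pal2012_thm32_sqrt_mul_realPeriodRat_twist_eq_of_prime_one_mod_four_holds hmod hmodD
          (by omega) hX he)))

/-- **X3♯(G-ord) ∩ `I₀*` at `p = 3`, `r_an = 0`, anomalous twists included (and, once its `hLamW`
lands, the DEGENERATE rows): Miller's `BSD(E,3)` from the PUBLISHED records + the two per-pair
inputs** (upper half: Wuthrich Thm. 16 on the minus eigenspace at `3` + De98 Prop. 4 weak form,
`AdditivePotMult.ClassX3Gord.missingUpperBoundAt_three_rankZero`). NOT a class theorem; nothing booked.
[cite: Delbourgo1998, Prop. 4 (p. 144)] [cite: Wuthrich2014, Thm. 16 (p. 397)]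
[cite: Miller2011LMS, §1 and Def. 1.1] -/
theorem ClassX3Gord.bsdp_three_rankZero_of_unitCoeffCert_of_lamEqW [Fact (Nat.Prime 3)]
    {W : WeierstrassCurve ℚ} [W.IsElliptic] [W.IsGloballyMinimal]
    (hDelG : Delbourgo1998.prop4_rankZero_constantCoeff_eq_unit_mul_of_potGoodOrd)
    (hDel98 : Delbourgo1998.prop4_rankZero_pow_dvd_constantCoeff)
    (hGZK : rank_eq_analyticRank_of_analyticRank_le_one) (hmod : hasEntireLFunction_rat)
    (hmodD : nonempty_modularParametrizationData)
    (hW16 : Wuthrich2014.thm16_halfEigenCharIdeal_dvd_cyclotomicPrime)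
    (hX : ClassX3Gord W 3) (hr : W.analyticRank = 0) {n : ℕ}
    (hcert : ∀ (V : WeierstrassCurve ℚ) [V.IsElliptic] [V.IsGloballyMinimal] (C : VariableChange ℚ),
      C • V.quadraticTwist ((-1) ^ ((3 : ℕ) / 2) * (3 : ℕ) : ℚ) = W → X3BranchUnitCoeffCertAt V 3 n)
    (hLamW : ∀ {κ : ZpExtension ℚ 3} {γ : Field.absoluteGaloisGroup ℚ} (D : W.SelmerDualData κ γ)
      (g : IwasawaAlgebra 3), κ.IsCyclotomic → κ.IsTopGenerator γ → D.IsTorsion →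
      D.charIdeal = Ideal.span {g} → HasUnitContent g → lam g = n) :
    BSDp W 3 :=
  have he : semistabilityIndex W 3 = 2 :=
    semistabilityIndex_eq_two_of_typeG_three W hX.typeGOrd.typeG hX.addv
  bsdp_of_missingPPartAt W 3 hGZK (by rw [hr]; exact zero_le_one)
    (missingPPartAt_of_lower_of_upper W 3
      (ClassX3Gord.missingLowerBoundAt_rankZero_of_unitCoeffCert_of_lamEqW hDelG hGZK hmod hmodD hW16
        hX (by norm_num) he hr hcert hLamW)
      (AdditivePotMult.ClassX3Gord.missingUpperBoundAt_three_rankZero hDel98 hGZK hmod hmodD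
        (thm16_minusEigenCharIdeal_dvd_cyclotomicThree_of_half hW16) hX he hr))

end EndStates

/-! ### §3 `hLamW` on the NON-degenerate (G-ord) rows from bsd-addord's COUNTS + the displayed EVALUATION -/

section Evaluation

variable {W : WeierstrassCurve ℚ} [W.IsElliptic] [W.IsGloballyMinimal] {p : ℕ} [hp : Fact p.Prime]

/-- **(G-ord, `e = 2`), ramified even line (`p ≥ 5` shape): `hLamW` from the PUBLISHED records
`h23`, `h414`, `hGrK`, `hLiftF` + the line datum `Φ₀` + the evaluation `hn`** (bsd-addord's
`X3Branch.algebraicCountW_of_facts`, then `X3Branch.lamEqW_of_count_of_eval`). [cite: GreenbergLNM1716, Props. 2.2, 2.4, 4.14]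
[cite: GreenbergVatsal2000, §2 pp. 26–30 (display (16), (11)), Props. (2.6), (2.8), Cor. (2.3)] -/
theorem X3Branch.lamEqW_of_facts_of_eval
    (h23 : datumSelmer_nonPrimitive_invariants)
    (h414 : Greenberg1999.prop414_noFiniteSubmodule_of_not_dvd_torsionOrder)
    (hGrK : Greenberg1999.imKummer_ge_strictCondition_goodOrdinary)
    (hLiftF : residualEpsilon_surjOn_of_lineRamifiedEven)
    (hp2 : p ≠ 2) (V : WeierstrassCurve ℚ) [V.IsElliptic] [V.IsGloballyMinimal] (hV : GoodOrd V p)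
    {C : VariableChange ℚ} (hC : C • V.quadraticTwist ((-1 : ℚ) ^ (p / 2) * p) = W)
    (S₀ : Finset (HeightOneSpectrum (𝓞 ℚ))) (hS₀ : ∀ v ∈ S₀, ((p : ℕ) : 𝓞 ℚ) ∉ v.asIdeal)
    (hS : ∀ v : HeightOneSpectrum (𝓞 ℚ), v ∉ S₀ → ((p : ℕ) : 𝓞 ℚ) ∉ v.asIdeal →
      W.HasGoodReductionAt v)
    (Φ₀ : AddSubgroup (W.geomTorsion (p : ℤ))) (hΦ : IsRationalLine W p Φ₀)
    (hram0 : ¬ LineUnramifiedAt W p Φ₀) (heven : LineEven W p Φ₀)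
    (hram : ∀ (K : Type) [Field K] [NumberField K] [(galRange (K := ℚ) K).Normal],
      Module.finrank ℚ K = 2 → (∃ θ : K, θ ^ 2 = algebraMap ℚ K ((-1) ^ (p / 2) * p)) →
      ¬ ∀ v : HeightOneSpectrum (𝓞 ℚ), ((p : ℕ) : 𝓞 ℚ) ∈ v.asIdeal →
        ∀ 𝔓 ∈ v.primesAbove, ∀ σ ∈ 𝔓.inertia (absoluteGaloisGroup ℚ), ∀ P ∈ Φ₀,
          σ • P = (if σ ∈ galRange (K := ℚ) K then P else -P))
    {n : ℕ}
    (hn : ∀ (κ : ZpExtension ℚ p), κ.IsCyclotomic →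
      p ^ (n + ∑ v ∈ S₀, delta W p v) =
        Nat.card (residualLineH1 W p κ S₀ Φ₀ hΦ) * Nat.card (residualQuotSelmer W p κ S₀ Φ₀ hΦ))
    {κ : ZpExtension ℚ p} {γ : Field.absoluteGaloisGroup ℚ} (D : W.SelmerDualData κ γ)
    (g : IwasawaAlgebra p) (hκ : κ.IsCyclotomic) (hγ : κ.IsTopGenerator γ) (hDt : D.IsTorsion)
    (hchar : D.charIdeal = Ideal.span {g}) (hμg : HasUnitContent g) : lam g = n :=
  X3Branch.lamEqW_of_count_of_eval S₀ hΦ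
    (fun D g hκ' hγ' hDt' hg hμ ↦ X3Branch.algebraicCountW_of_facts h23 h414 hGrK hLiftF hp2 V hV hC S₀
      hS₀ hS Φ₀ hΦ hram0 heven hram D g hκ' hγ' hDt' hg hμ)
    hn D g hκ hγ hDt hchar hμg

/-- **(G-ord, `e = 2`), even line with non-trivial `Γ_ℚ`-action and a DISPLAYED residual lifting
(`p = 3` non-degenerate shape): `hLamW` from `h23`, `h414`, `hGrK` + `Φ₀` + `hlift` + the evaluation
`hn`** (bsd-addord's `X3Branch.algebraicCountW_of_facts_of_lifting`). [cite: GreenbergLNM1716, Props. 2.2, 2.4, 4.14]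
[cite: GreenbergVatsal2000, §2 pp. 26–30 (display (16), (11)), Props. (2.6), (2.8), Cor. (2.3)] -/
theorem X3Branch.lamEqW_of_facts_of_lifting_of_eval
    (h23 : datumSelmer_nonPrimitive_invariants)
    (h414 : Greenberg1999.prop414_noFiniteSubmodule_of_not_dvd_torsionOrder)
    (hGrK : Greenberg1999.imKummer_ge_strictCondition_goodOrdinary)
    (hp2 : p ≠ 2) (V : WeierstrassCurve ℚ) [V.IsElliptic] [V.IsGloballyMinimal] (hV : GoodOrd V p)
    {C : VariableChange ℚ} (hC : C • V.quadraticTwist ((-1 : ℚ) ^ (p / 2) * p) = W)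
    (S₀ : Finset (HeightOneSpectrum (𝓞 ℚ))) (hS₀ : ∀ v ∈ S₀, ((p : ℕ) : 𝓞 ℚ) ∉ v.asIdeal)
    (hS : ∀ v : HeightOneSpectrum (𝓞 ℚ), v ∉ S₀ → ((p : ℕ) : 𝓞 ℚ) ∉ v.asIdeal →
      W.HasGoodReductionAt v)
    (Φ₀ : AddSubgroup (W.geomTorsion (p : ℤ))) (hΦ : IsRationalLine W p Φ₀)
    (heven : LineEven W p Φ₀)
    (hnt : ∃ (σ : absoluteGaloisGroup ℚ) (P : W.geomTorsion (p : ℤ)), P ∈ Φ₀ ∧ σ • P ≠ P)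
    (hram : ∀ (K : Type) [Field K] [NumberField K] [(galRange (K := ℚ) K).Normal],
      Module.finrank ℚ K = 2 → (∃ θ : K, θ ^ 2 = algebraMap ℚ K ((-1) ^ (p / 2) * p)) →
      ¬ ∀ v : HeightOneSpectrum (𝓞 ℚ), ((p : ℕ) : 𝓞 ℚ) ∈ v.asIdeal →
        ∀ 𝔓 ∈ v.primesAbove, ∀ σ ∈ 𝔓.inertia (absoluteGaloisGroup ℚ), ∀ P ∈ Φ₀,
          σ • P = (if σ ∈ galRange (K := ℚ) K then P else -P))
    (hlift : ∀ (κ : ZpExtension ℚ p), κ.IsCyclotomic →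
      ∀ s ∈ residualQuotSelmer W p κ S₀ Φ₀ hΦ, ∃ x ∈ residualTorsionH1 W p κ S₀,
        residualEpsilon W p κ Φ₀ hΦ x = s)
    {n : ℕ}
    (hn : ∀ (κ : ZpExtension ℚ p), κ.IsCyclotomic →
      p ^ (n + ∑ v ∈ S₀, delta W p v) =
        Nat.card (residualLineH1 W p κ S₀ Φ₀ hΦ) * Nat.card (residualQuotSelmer W p κ S₀ Φ₀ hΦ))
    {κ : ZpExtension ℚ p} {γ : Field.absoluteGaloisGroup ℚ} (D : W.SelmerDualData κ γ)
    (g : IwasawaAlgebra p) (hκ : κ.IsCyclotomic) (hγ : κ.IsTopGenerator γ) (hDt : D.IsTorsion)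
    (hchar : D.charIdeal = Ideal.span {g}) (hμg : HasUnitContent g) : lam g = n :=
  X3Branch.lamEqW_of_count_of_eval S₀ hΦ
    (fun D g hκ' hγ' hDt' hg hμ ↦ X3Branch.algebraicCountW_of_facts_of_lifting h23 h414 hGrK hp2 V hV
      hC S₀ hS₀ hS Φ₀ hΦ heven hnt hram hlift D g hκ' hγ' hDt' hg hμ)
    hn D g hκ hγ hDt hchar hμg

end Evaluation

/-! ### §4 The certificate in the census cell's Q6 RECORD FORMAT (`CensusQ6.Gord[Odd]FirstUnitIndexAt`) -/

section Records

variable {W : WeierstrassCurve ℚ} [W.IsElliptic] [W.IsGloballyMinimal] {p : ℕ} [hp : Fact p.Prime]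

/-- **Q6 record ⟹ the `W`-keyed certificate on X3♯(G-ord, `e = 2`), `p ≡ 1 (mod 4)`.** The census
cell's record `CensusQ6.GordFirstUnitIndexAt W p n₀` (first unit coefficient of the Néron-normalised
branch `ϖ·L_p(f, α_V, ω^{(p−1)/2}, T)` of EVERY good-ordinary twist model has index `n₀`) gives
`X3BranchUnitCoeffCertAt V p n₀` for every twist model `V` of `W` (all good ordinary,
`TypeGOrd.goodOrd_of_pStar_twist_model`; the multiplicative disjuncts of the telescope are void).
[cite: MazurTateTeitelbaum1986Invent, §I.13] [cite: SilvermanAEC2009, VII.5 Prop. 5.1] -/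
theorem ClassX3Gord.unitCoeffCert_of_gordFirstUnitIndex (hX : ClassX3Gord W p)
    (he : semistabilityIndex W p = 2) (hp4 : p % 4 = 1) {n₀ : ℕ}
    (h : CensusQ6.GordFirstUnitIndexAt W p n₀)
    (V : WeierstrassCurve ℚ) [V.IsElliptic] [V.IsGloballyMinimal] (C : VariableChange ℚ)
    (hC : C • V.quadraticTwist ((-1) ^ (p / 2) * p : ℚ) = W) : X3BranchUnitCoeffCertAt V p n₀ := by
  intro N _ f B ϖ hred hf hϖ
  have hp2 : p ≠ 2 := by omega
  have heven' : Even (p / 2) := ⟨p / 4, by omega⟩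
  have hgood : GoodOrd V p := TypeGOrd.goodOrd_of_pStar_twist_model hp2 hX.typeGOrd hX.addv he ⟨C, hC⟩
  have hC' : C • V.quadraticTwist (p : ℚ) = W := by
    rw [← pStar_eq_self_of_mod_four_eq_one hp4]; exact hC
  rw [if_pos heven'] at hϖ
  rw [X3Branch.branch_eq_of_goodOrd hgood hred, if_pos heven']
  exact (h V C hgood hC' f hf ϖ hϖ).2

/-- **Q6 record ⟹ the `W`-keyed certificate on X3♯(G-ord, `e = 2`), `p ≡ 3 (mod 4)`** (`p = 3`
included; MINUS branch, twist by `−p`, `Ω⁻`; record `CensusQ6.GordOddFirstUnitIndexAt W p n₀`).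
[cite: MazurTateTeitelbaum1986Invent, §I.13] [cite: SilvermanAEC2009, VII.5 Prop. 5.1] -/
theorem ClassX3Gord.unitCoeffCert_of_gordOddFirstUnitIndex (hX : ClassX3Gord W p)
    (he : semistabilityIndex W p = 2) (hp4 : p % 4 = 3) {n₀ : ℕ}
    (h : CensusQ6.GordOddFirstUnitIndexAt W p n₀)
    (V : WeierstrassCurve ℚ) [V.IsElliptic] [V.IsGloballyMinimal] (C : VariableChange ℚ)
    (hC : C • V.quadraticTwist ((-1) ^ (p / 2) * p : ℚ) = W) : X3BranchUnitCoeffCertAt V p n₀ := by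
  intro N _ f B ϖ hred hf hϖ
  have hp2 : p ≠ 2 := by omega
  have hodd : ¬ Even (p / 2) := by rw [Nat.not_even_iff_odd]; exact ⟨p / 4, by omega⟩
  have hgood : GoodOrd V p := TypeGOrd.goodOrd_of_pStar_twist_model hp2 hX.typeGOrd hX.addv he ⟨C, hC⟩
  have hC' : C • V.quadraticTwist (-(p : ℚ)) = W := by
    rw [← pStar_eq_neg_of_mod_four_eq_three hp4]; exact hC
  rw [if_neg hodd] at hϖ
  rw [X3Branch.branch_eq_of_goodOrd hgood hred, if_neg hodd]
  exact (h V C hgood hC' f hf ϖ hϖ).2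

end Records

end Summit.BirchSwinnertonDyer.Rank1Residual.Additive
end
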